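import Summits.Ventures.PercRepro.Night2FatXFreePoint
import Summits.Ventures.PercRepro.Night2FatXDistOne

/-!
# night-2: the free point from the geometry — off the basis lines, with the two off-points generic

A target `T ⊇ Q ∪ {x, y}` is unloaded as soon as (i) `y` lies on no basis line (`rk {a, b, y} = 3` for all basis points
`a ≠ b` off `w₀`) — then no distance-1 load, whose line is `Y ∪ {a, b}` (`exists_basis_line_of_dist_one_fat`), contains
`y` — and (ii) no line of `V` with at least three points is coplanar with the two off-points `w₀, x` (the OFF-POINTS ARE
GENERIC: `rk (R ∪ {w₀, x}) ≥ 4`) — then no distance-2 load exists at all (`rkN_line_off_le_three_of_no_gtPts`):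
**`dload_eq_zero_of_free_of_generic`**.  Hence **`basis_pair_fair_fat_of_free_point_generic`**: with generic off-points,
a lossy basis pair with `N ≥ 8` and a point of `W ∖ {x}` off all its basis lines receives its fair share.
Paper `proofs/NIGHT-2-g33.md` §6 (d).
-/

namespace PercRepro.Shadow

open PercRepro.ThmH PercRepro.PerFlat

variable {α : Type*} [DecidableEq α] {M : Matroid α} [M.Finite] {G : Finset α}

/-- **A target through `x` and a free point `y` is unloaded when the off-points are generic.** -/
theorem dload_eq_zero_of_free_of_generic (hG : G ∈ flatsQ M (5 + 1)) (hd : (gr M \ G).card = 2)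
    (hk : kColoops M G = 1) (hs : ∀ e ∈ gr M, ∀ f ∈ gr M, e ≠ f → rkN M {e, f} = 2)
    (hl : ∀ e ∈ gr M, M.Indep {e}) (hfat : (fatClosures M 5 G 2).card ≤ 1) {B₀ : Finset α}
    (hB₀ : B₀ ∈ thinMembers M 5 G) {w₀ x : α} (hD : G \ clF M B₀ = {w₀, x})
    (hgen : ∀ R ⊆ G \ coloops M G, rkN M R = 2 → 3 ≤ R.card → 4 ≤ rkN M (insert w₀ (insert x R)))
    {B : Finset α} (hB : B ∈ thinMembers M 5 G) (hnP : ¬ bigP M G B) {z : α} (hz : z ∈ G \ clF M B)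
    (hx : x ∉ insert z B) {y : α} (hy : y ∈ G \ insert z B) (hxy : x ≠ y)
    (hfree : ∀ a ∈ (insert z B \ coloops M G).erase w₀, ∀ b ∈ (insert z B \ coloops M G).erase w₀, a ≠ b →
      rkN M {a, b, y} = 3)
    {T : Finset α} (hT : T ∈ tgtSets M 5 G B z) (hxT : x ∈ T) (hyT : y ∈ T) :
    dload M 5 G (bigP M G) (dshGT2 M 5 G) T = 0 := by
  by_contra hload
  have hTG : T ⊆ G := subset_G_of_mem_shadowAt (mem_tgtSets.1 hT).1
  obtain ⟨R, hR, hR2, hR3, hcase⟩ := loaded_fat_target_dichotomy hG hd hk hs hl hfat hB₀ hD hTG hload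
  rcases hcase with ⟨hRc, -⟩ | ⟨-, hcop⟩
  · obtain ⟨a, ha, b, hb, hab, hrk⟩ :=
      exists_basis_line_of_dist_one_fat hG hd hk hs hB hnP hz hT hxT hx hR hR2 hRc
    have hyY : y ∈ (T \ insert z B).erase x :=
      Finset.mem_erase.2 ⟨fun h' => hxy h'.symm, Finset.mem_sdiff.2 ⟨hyT, (Finset.mem_sdiff.1 hy).2⟩⟩
    have hsub : ({a, b, y} : Finset α) ⊆ insert a (insert b ((T \ insert z B).erase x)) := by
      intro e he
      rw [Finset.mem_insert, Finset.mem_insert, Finset.mem_singleton] at he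
      rw [Finset.mem_insert, Finset.mem_insert]
      rcases he with rfl | rfl | rfl
      · exact Or.inl rfl
      · exact Or.inr (Or.inl rfl)
      · exact Or.inr (Or.inr hyY)
    have h1 := rkN_mono (M := M) hsub
    rw [hrk, hfree a ha b hb hab] at h1
    omega
  · have hRV : R ⊆ G \ coloops M G := fun r hr =>
      Finset.sdiff_subset_sdiff hTG (Finset.Subset.refl _) (Finset.mem_sdiff.1 (hR hr)).1
    have := hgen R hRV hR2 hR3
    omega

/-- **The fat case of (FAIR) with generic off-points from a point of `W` off the basis lines** (`N ≥ 8`). -/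
theorem basis_pair_fair_fat_of_free_point_generic (hG : G ∈ flatsQ M (5 + 1)) (hd : (gr M \ G).card = 2)
    (hk : kColoops M G = 1) (hs : ∀ e ∈ gr M, ∀ f ∈ gr M, e ≠ f → rkN M {e, f} = 2)
    (hl : ∀ e ∈ gr M, M.Indep {e}) (hfat : (fatClosures M 5 G 2).card ≤ 1)
    {B₀ : Finset α} (hB₀ : B₀ ∈ thinMembers M 5 G) {w₀ x : α} (hD : G \ clF M B₀ = {w₀, x}) (hne : w₀ ≠ x)
    (hgen : ∀ R ⊆ G \ coloops M G, rkN M R = 2 → 3 ≤ R.card → 4 ≤ rkN M (insert w₀ (insert x R)))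
    {B : Finset α} (hB : B ∈ thinMembers M 5 G) (hnP : ¬ bigP M G B) {z : α} (hz : z ∈ G \ clF M B)
    (hl0 : loss M 5 G B z ≠ 0) (hw₀ : w₀ ∈ insert z B) (hx : x ∉ insert z B) {y : α}
    (hy : y ∈ G \ insert z B) (hxy : x ≠ y) (hN : 8 ≤ (G \ insert z B).card)
    (hfree : ∀ a ∈ (insert z B \ coloops M G).erase w₀, ∀ b ∈ (insert z B \ coloops M G).erase w₀, a ≠ b →
      rkN M {a, b, y} = 3) :
    loss M 5 G B z ≤ rhoL M 5 G B z * lossIncomeH M 5 G (bigP M G) (dshGT2 M 5 G) B z :=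
  basis_pair_fair_fat_of_free_point hG hd hk hs hl hfat hB₀ hD hne hB hnP hz hl0 hw₀ hx hy hxy hN
    (fun _ hT hxT hyT => dload_eq_zero_of_free_of_generic hG hd hk hs hl hfat hB₀ hD hgen hB hnP hz hx hy hxy
      hfree hT hxT hyT)

end PercRepro.Shadow
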